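import Mathlib
import Literature.NumberTheory.LFunctions.Zhang2022.TypedSection12B
import HarnessLib

/-!
# Zhang (2022) §12, Lemmas 12.2–12.3: the analytic proof steps in the RELATIVE reading
# (error terms carrying `(∏_{q∣dr}(1 − q⁻¹)⁻¹)²`, the currency of `Skeleton.Lemma83Rel`/`Lemma84Rel`)

Topic `Literature/NumberTheory/LFunctions/Zhang2022` (Landau–Siegel audit tree; verdict-neutral).
Y. Zhang, *Discrete mean estimates and the Landau–Siegel zero*, arXiv:2211.02515v1 (2022)
[Zhang2022LandauSiegel] — **an unrefereed manuscript under adjudication; every `def … : Prop` below is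
a CLAIM OF THE MANUSCRIPT in a stated reading, STATED NOT ASSERTED; typed ≠ discharged.** ZHANG-L
discharge lane, WP12 (typer seat, task T2 of wp12/WP12-PLAN.md §3); companion of `TypedSection12B`
(L3-t5: the proof steps `U024`, `U025`, `U026read`, `Eq1210`, `Eq1211`, `U030` with ABSOLUTE errors).

Why this file exists. The analytic cores of Lemmas 12.2–12.3 — u024/u025 ("In a way similar to the
proof of Lemma 8.4, by lemma 8.2 [8.3] and 5.8 …", p. 69), (12.11) ("similar to that of ." — blank,
p. 70), u030 ("In a way similar to the proof of Lemma 12.1 [12.2] …", p. 70) — are typed in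
`TypedSection12B` with the ABSOLUTE `O(𝓛⁻¹⁵)` / `O(α₁)` the manuscript prints. The only route the tree
holds is the one of Lemma 8.4: Perron + Landau contour + the continuation `𝒰_j(d,r;·)` of Lemma 8.3
whose approach to `Π(d,r)` is known only RELATIVELY, `|𝒰 − Π| ≤ C𝓛⁻⁸·∏_{q∣dr}(1−q⁻¹)⁻¹`
(`Skeleton.Lemma83Rel` (iii′), rows G-adj1-1 / G-d55-3), and `|Π(d,r)| ≤ (∏_{q∣dr}(1−q⁻¹)⁻¹)²`; the
circle term therefore carries the factor `(∏_{q∣dr}(1−q⁻¹)⁻¹)²` exactly as in the banked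
`Skeleton.Lemma84Rel` (proved from `Lemma83Rel`: `Section8Lemma84.lemma84Rel_of_lemma83Rel`). The
nodes below are the u024/u025/u026/(12.10)/(12.11)/u030 claims and the ε-free form of Lemma 12.3 with
that factor; the consumers ((12.12) `Eq1212`, `Mid1225`, `Top1225Ex`) absorb any fixed power of it
through the `(d,r)`-weights (`Section8FrontEnd44ReductionRel.weight_antidiagonal_rel_le`,
`relFac_le_prod`; write `Π̂(n) := ∏_{q∣n}(1 − q⁻¹)⁻¹ = n/φ(n)`). Absolute ⇒ relative comparison edges and the relative Cauchy-step edges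
(`DedU026readRel`, `DedEq1210L15Rel`, `DedLemma123FormRel`) are PROVED in the companion files
`Section12RelCompare`, `Section12RelEdges`. Spelling of the factor = that of `Skeleton.Lemma84Rel` and
`TypedSection10Rel` (RT-01′): `(∏ q ∈ (d * r).primeFactors, (1 - (q : ℝ)⁻¹)⁻¹) ^ 2`, no new object
(`|Π(d,r)| ≤` it: `Typed.Sec10Rel.norm_PiW_le_relFactor`). Evidence that the absolute nodes are underivable by
the route (WP12-PLAN §4e policy «Rel twins on STUCK evidence»): zl-libA-p3's STUCK-SHAPE line of
2026-08-27T00:13Z for `U030` (`Lemma84.norm_quot_sub_model_le` error `‖Π‖·C₅₈𝓛⁻¹⁵ + 32K³·C₈₃𝓛⁻⁸Π̂·|L′|·α =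
O(𝓛⁻¹⁵Π̂²)`, unbounded in `(d,r)`), the same engine serving u025.

| node | reading of | printed locus |
|---|---|---|
| `U024Rel c′` | `Sec12B.U024` (g-weights + Perron for the window sum, `dr ≤ P″₁/T`, `|w| = α`) | p. 69, tex L3528 |
| `U025Rel c′` | `Sec12B.U025`, first conjunct (Perron integral = `L′(1,χ)Π(d,r)·circ025(w) + O(…)`; the closed form of `circ025` is the THEOREM `Sec12B.circ025_eq`) | p. 69, tex L3534 |
| `U026readRel c′` | `Sec12B.U026read` (the Cauchy step, `∂_w|_{w=0}`, error `O(𝓛⁻⁶·Π̂²)`) | pp. 69–70, tex L3541 |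
| `Eq1210LeRel c′ E`, `Eq1210L15Rel c′` | `Sec12B.Eq1210 E` on the closed range `dr ≤ P″₁/T` (= `Sec12C.rngLow`; print `<`) | p. 69, (12.10) |
| `Eq1211W c′` | `Sec12B.Eq1211`, weak-relative: `‖Σ‖ ≤ C𝓛⁻⁴·(dr/φ(dr))⁴` on `P″₁/T < dr ≤ P″₁` = the inline hypothesis of the landed edge `Typed.Sec12C.mid1225_of_eq1211_weak4` (p477334) VERBATIM | p. 69, (12.11) |
| `U030Rel c′` | `Sec12B.U030` (`P″₁ < dr < P₂`, `|w| = α`) = the STUCK-SHAPE target of zl-libA-p3 (2026-08-27T00:13Z) VERBATIM | p. 70, tex L3564 |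
| `Lemma123FormRel c′` | the ε-free evaluation form of Lemma 12.3 (`Sec12B.lemma123_form_of_u030`'s conclusion) with error `C𝓛⁻¹⁵·Π̂²` | pp. 70–71 |
| `U024RelA`, `U026readRelA`, `Eq1210LeRelA E`/`Eq1210L15RelA` (appended) | u024 / u026 / (12.10) in the Euler-majorant currency `∏_{q∣dr}(1 + A/q)`, `∃ A ≥ 0` (the unsmoothing step's natural output; `Π̂² ≤ ∏(1+6/q)`) | pp. 69–70 |

What is deliberately NOT here: any proof of a CLAIM (the cores are WP12 prover items: C-U024, C-U025,
C-U030, the (12.11) core), Lemma 12.1 (its ranges are THEOREMS: `Sec12B.U020_holds`,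
`sum121_range_one`, `sum121_range_two_weak`), and anything about Theorems 1–2 of the manuscript or
Landau–Siegel zeros. Statement file: no `instance`, no `notation`; objects by name from
`TypedSection12B` (`sum122`, `main1210`, `innerSum`, `gSeries`, `lineInt024`, `circ025`, `bracket122`,
`modelInt026`, `innerSumLow`, `circ030`, `rhs033`), `Skeleton.PiW/P1pp/P2pp/bigT/alpha/ell`.

## References

* Y. Zhang, arXiv:2211.02515v1 (2022), §12 Lemma 12.2 (12.10)–(12.11) and its proof pp. 69–70
  (tex L3502–L3549), Lemma 12.3 and its proof pp. 70–71 (tex L3551–L3590); §8 Lemmas 8.3–8.4 pp. 46–47.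
  [cite: Zhang2022LandauSiegel, §12 Lemmas 12.2–12.3]
-/

noncomputable section

open Complex Real ComplexConjugate

namespace Literature.NumberTheory.LFunctions.Zhang2022.Typed.Sec12B

open Literature.NumberTheory.LFunctions.Zhang2022.Skeleton

/-! ## Lemma 12.2: u024, u025, u026, (12.10), (12.11) in the relative reading -/

section LemmaTwelveTwoRel

variable (c' : ℝ)

/-- **Z22:§12.u024, RELATIVE reading** of `Sec12B.U024`: for `dr ≤ P″₁/T`, `|w| = α`, the window sum
`Σ_{P″₁/dr<l<P″₂/dr} χ(l)ξ_j(l;d,r)/l^{1−β₆+w}` equals the `g`-weighted series and the Perron integral on `(1)`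
each up to `C𝓛⁻¹⁵·Π̂(dr)²` (print: `O(𝓛⁻¹⁵)`, "By (4) and (4)" — (4.2)–(4.3)). CLAIM.
[cite: Zhang2022LandauSiegel, §12 proof of Lemma 12.2, p.69] -/
def U024Rel : Prop :=
  ∃ C : ℝ, ForAllLarge fun D _ χ => AssumptionA D χ →
    ∀ j ∈ ({1, 2, 3} : Finset ℕ), ∀ d r : ℕ, 1 ≤ d → 1 ≤ r →
      ((d * r : ℕ) : ℝ) ≤ P1pp D / bigT D → ∀ w : ℂ, ‖w‖ = alpha D →
        ‖innerSum c' χ j d r w - gSeries c' χ j d r w‖ ≤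
            C * (ell D ^ 15)⁻¹ * (∏ q ∈ (d * r).primeFactors, (1 - (q : ℝ)⁻¹)⁻¹) ^ 2 ∧
        ‖innerSum c' χ j d r w - lineInt024 c' χ j d r w‖ ≤
            C * (ell D ^ 15)⁻¹ * (∏ q ∈ (d * r).primeFactors, (1 - (q : ℝ)⁻¹)⁻¹) ^ 2

/-- **Z22:§12.u025, RELATIVE reading** of the first conjunct of `Sec12B.U025`: for `dr ≤ P″₁/T`, `|w| = α`,
"the right side above is equal to `L′(1,χ)Π(d,r)·(2πi)⁻¹∫_{|s|=5α}(…)((P″₂/dr)^s − (P″₁/dr)^s)ds/s + O(𝓛⁻¹⁵)`"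
with the error `C𝓛⁻¹⁵·Π̂(dr)²` the Lemma 8.3-continuation delivers (`|𝒰 − Π| ≤ C𝓛⁻⁸∏(1−q⁻¹)⁻¹`,
`|Π| ≤ Π̂²`). The second conjunct of `U025` (the residue computation of `circ025`) is the THEOREM
`Sec12B.circ025_eq` and is not repeated. CLAIM. [cite: Zhang2022LandauSiegel, §12 proof of Lemma 12.2, p.69] -/
def U025Rel : Prop :=
  ∃ C : ℝ, ForAllLarge fun D _ χ => AssumptionA D χ →
    ∀ j ∈ ({1, 2, 3} : Finset ℕ), ∀ d r : ℕ, 1 ≤ d → 1 ≤ r →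
      ((d * r : ℕ) : ℝ) ≤ P1pp D / bigT D → ∀ w : ℂ, ‖w‖ = alpha D →
        ‖lineInt024 c' χ j d r w - deriv χ.LFunction 1 * PiW χ d r * circ025 c' D j d r w‖ ≤
          C * (ell D ^ 15)⁻¹ * (∏ q ∈ (d * r).primeFactors, (1 - (q : ℝ)⁻¹)⁻¹) ^ 2

/-- **Z22:§12.u026 (with its factor), RELATIVE reading** of `Sec12B.U026read`: "It follows by Cauchy' integral
formula that `∂_w((dr/P″₁)^{β₆−w}Σ_{P″₁/dr<l<P″₂/dr}…)|_{w=0} = [L′(1,χ)Π(d,r)β_{j+1}β_{j+2}]·∂_w(∫₁^{P^{0.004}}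
y^{β₆−w−1}dy)|_{w=0} + O(𝓛⁻⁶)`", error `C𝓛⁻⁶·Π̂(dr)²` (Cauchy's estimate on `|w| = α` from `U024Rel`,
`U025Rel`: edge `DedU026readRel`, proved in `Section12RelEdges`). CLAIM.
[cite: Zhang2022LandauSiegel, §12 proof of Lemma 12.2, pp.69–70] -/
def U026readRel : Prop :=
  ∃ C : ℝ, ForAllLarge fun D _ χ => AssumptionA D χ →
    ∀ j ∈ ({1, 2, 3} : Finset ℕ), ∀ d r : ℕ, 1 ≤ d → 1 ≤ r →
      ((d * r : ℕ) : ℝ) ≤ P1pp D / bigT D →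
        ‖deriv (bracket122 c' χ j d r) 0 -
            deriv χ.LFunction 1 * PiW χ d r * betaJ c' D (j + 1) * betaJ c' D (j + 2) *
              deriv (modelInt026 D) 0‖ ≤
          C * (ell D ^ 6)⁻¹ * (∏ q ∈ (d * r).primeFactors, (1 - (q : ℝ)⁻¹)⁻¹) ^ 2

/-- **Z22:(12.10), RELATIVE reading** on the CLOSED range `dr ≤ P″₁/T` (the range `Sec12C.rngLow` of (12.12) and
of the proof's own displays u024–u026; the statement (12.10) prints `<`): "`Σ_l χ(l)ϰ̄₁₃(drl)ξ_j(l;d,r)/l =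
b*L′(1,χ)Π(d,r)(log P)β_{j+1}β_{j+2} + O`" [error term blank in print, tex L3504] with the error
`C·E(D)·Π̂(dr)²`; the absolute reading is `Sec12B.Eq1210 E`. CLAIM. [cite: Zhang2022LandauSiegel, §12 (12.10) p.69] -/
def Eq1210LeRel (E : ℕ → ℝ) : Prop :=
  ∃ C : ℝ, ForAllLarge fun D _ χ => AssumptionA D χ →
    ∀ j ∈ ({1, 2, 3} : Finset ℕ), ∀ d r : ℕ, 1 ≤ d → 1 ≤ r →
      ((d * r : ℕ) : ℝ) ≤ P1pp D / bigT D →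
        ‖sum122 c' χ j d r - main1210 c' χ j d r‖ ≤
          C * E D * (∏ q ∈ (d * r).primeFactors, (1 - (q : ℝ)⁻¹)⁻¹) ^ 2

/-- **Z22:(12.10), relative reading at the rate `O(𝓛⁻¹⁵)`** the printed proof chain supports (`O(𝓛⁻¹⁵)` on
`|w| = α`, Cauchy ⇒ `O(𝓛⁻⁶)` for `∂_w`, times `1/log P₁ = 1/(0.504𝓛⁹)`; edge `DedEq1210L15Rel` from `U026readRel`,
proved in `Section12RelEdges`). CLAIM. [cite: Zhang2022LandauSiegel, §12 (12.10) pp.69–70] -/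
def Eq1210L15Rel : Prop := Eq1210LeRel c' fun D => (ell D ^ 15)⁻¹

/-- **Z22:(12.11), WEAK-RELATIVE reading `Eq1211W`** = the inline hypothesis of the LANDED edge
`Typed.Sec12C.mid1225_of_eq1211_weak4` (zl-w12-p1, `Section12Mid1225` rev 2, p477334; referee words zl-w12-ref-2
2026-08-27T00:04Z "take the WEAK edge; typer names `Eq1211W` := that binder VERBATIM" and 00:28Z "exponent 4: the head
estimate in tree, `XiZeroMajorant.xiZeroTailMean_logFree`, reaches `𝓛^{−4.6}`") — for `P″₁/T < dr ≤ P″₁`,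
`‖Σ_l χ(l)ϰ̄₁₃(drl)ξ_j(l;d,r)/l‖ ≤ C𝓛⁻⁴·(dr/φ(dr))⁴`. The printed `Sec12B.Eq1211` ("`≪ α₁`", `α₁ = α𝓛 = π𝓛⁻⁸`;
proof "similar to that of ." — blank, row G-L3t5-2) is stronger than what is consumed and, at the window edge
`dr = P″₁`, stronger than what the route gives (`sup|ϰ₁₃| = 𝓛^{1.1}/(0.504𝓛⁹)`, ratio `0.63𝓛^{0.1} → ∞`); the Lemma
8.4-type route yields `O((|L′(1,χ)| + (1+log T)⁴)/log P₁)·(dr/φ(dr))^k = O(𝓛^{−4.6}(dr/φ(dr))^k)`, inside this node;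
any exponent `> 3.1` suffices for `Mid1225` (`Typed.Sec12C.mid1225_of_sum122_bound`).
`Sec12B.Eq1211 → Eq1211W` (`Section12RelCompare.eq1211W_of_eq1211`); `Eq1211W → Mid1225` is p1's theorem.
CLAIM. [cite: Zhang2022LandauSiegel, §12 (12.11) p.69] -/
def Eq1211W : Prop :=
  ∃ C : ℝ, ForAllLarge fun D _ χ => AssumptionA D χ →
    ∀ j ∈ ({1, 2, 3} : Finset ℕ), ∀ d r : ℕ, 1 ≤ d → 1 ≤ r →
      P1pp D / bigT D < ((d * r : ℕ) : ℝ) → ((d * r : ℕ) : ℝ) ≤ P1pp D →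
        ‖sum122 c' χ j d r‖ ≤
          C * (ell D ^ 4)⁻¹ * ((((d * r : ℕ) : ℝ)) / Nat.totient (d * r)) ^ 4

/-- `Z22:§12.u026` deduction in the relative reading: the Cauchy step from the two circle claims,
`U024Rel → U025Rel → U026readRel` (the absolute twin is the THEOREM `Sec12B.u026read_of_u024_u025`;
this one is PROVED in `Section12RelEdges`). [cite: Zhang2022LandauSiegel, §12 proof of Lemma 12.2, pp.69–70] -/
def DedU026readRel : Prop := U024Rel c' → U025Rel c' → U026readRel c'

/-- `Z22:(12.10)` deduction in the relative reading: "Gathering these results together we obtain (12.10)" —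
`U026readRel → Eq1210L15Rel` (u023 and u027 are THEOREMS `Sec12B.U023_holds`, `U027_holds`; the absolute twin is
`Sec12B.eq1210L15_of_steps`; PROVED in `Section12RelEdges`). [cite: Zhang2022LandauSiegel, §12 (12.10) p.70] -/
def DedEq1210L15Rel : Prop := U026readRel c' → Eq1210L15Rel c'

end LemmaTwelveTwoRel

/-! ## Lemma 12.3: u030 and the ε-free evaluation form in the relative reading -/

section LemmaTwelveThreeRel

variable (c' : ℝ)

/-- **Z22:§12.u030, RELATIVE reading** of `Sec12B.U030`: for `P″₁ < dr < P₂`, `|w| = α`, "`Σ_{l<P″₂/dr}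
χ(l)ξ_j(l;d,r)/l^{1−β₆+w} = L′(1,χ)Π(d,r)×(2πi)⁻¹∫_{|s|=5α}(…)(P″₂/dr)^s ds/s + O(𝓛⁻¹⁵)`" with the error
`C𝓛⁻¹⁵·Π̂(dr)²` (Lemma 8.3-continuation; kernel `(P″₂/dr)^s/s`, `|(P″₂/dr)^s| ≤ P^{0.02α}` on the circle).
CLAIM. [cite: Zhang2022LandauSiegel, §12 proof of Lemma 12.3, p.70] -/
def U030Rel : Prop :=
  ∃ C : ℝ, ForAllLarge fun D _ χ => AssumptionA D χ →
    ∀ j ∈ ({1, 2, 3} : Finset ℕ), ∀ d r : ℕ, 1 ≤ d → 1 ≤ r →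
      P1pp D < ((d * r : ℕ) : ℝ) → ((d * r : ℕ) : ℝ) < Skeleton.P2 D → ∀ w : ℂ, ‖w‖ = alpha D →
        ‖innerSumLow c' χ j d r w - deriv χ.LFunction 1 * PiW χ d r * circ030 c' D j d r w‖ ≤
          C * (ell D ^ 15)⁻¹ * (∏ q ∈ (d * r).primeFactors, (1 - (q : ℝ)⁻¹)⁻¹) ^ 2

/-- **Z22:Lem12.3 in its ε-free evaluation form, RELATIVE reading**: for `1 ≤ j ≤ 3`, `d, r ≥ 1`, `P″₁ < dr < P₂`,
`Σ_l χ(l)ϰ̄₁₃(drl)ξ_j(l;d,r)/l = −(L′(1,χ)Π(d,r)/log P₁)·[rhs033] + O(𝓛⁻¹⁵·Π̂(dr)²)` — the conclusion of the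
THEOREM `Sec12B.lemma123_form_of_u030` (absolute, ⇐ `U030`) with the factor; it is what `Sec12C.Top1225Ex`
consumes (`𝓦ˣ_j(dr) = −rhs033`, `Sec12C.frakwEx_natCast`). Edge `DedLemma123FormRel` from `U030Rel`, PROVED in
`Section12RelEdges`. CLAIM. [cite: Zhang2022LandauSiegel, §12 Lemma 12.3 pp.70–71] -/
def Lemma123FormRel : Prop :=
  ∃ C : ℝ, ForAllLarge fun D _ χ => AssumptionA D χ →
    ∀ j ∈ ({1, 2, 3} : Finset ℕ), ∀ d r : ℕ, 1 ≤ d → 1 ≤ r →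
      P1pp D < ((d * r : ℕ) : ℝ) → ((d * r : ℕ) : ℝ) < Skeleton.P2 D →
        ‖sum122 c' χ j d r +
            1 / (Real.log (Skeleton.P1 D) : ℂ) * (deriv χ.LFunction 1 * PiW χ d r) * rhs033 c' D j d r‖ ≤
          C * (ell D ^ 15)⁻¹ * (∏ q ∈ (d * r).primeFactors, (1 - (q : ℝ)⁻¹)⁻¹) ^ 2

/-- `Z22:Lem12.3.pf` deduction in the relative reading: `U030Rel → Lemma123FormRel` (u029, u031, u033 are
THEOREMS; Cauchy's estimate on `|w| = α` with the factor `Π̂(dr)²` as a constant in `w`; PROVED in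
`Section12RelEdges`). [cite: Zhang2022LandauSiegel, §12 proof of Lemma 12.3, pp.70–71] -/
def DedLemma123FormRel : Prop := U030Rel c' → Lemma123FormRel c'

end LemmaTwelveThreeRel

/-! ## The Euler-majorant currency `∏_{q∣dr}(1 + A/q)` for the unsmoothing step u024 and its descendants

Appended 2026-08-27 (referee remark zl-w12-ref-1 00:32Z (R1)): the unsmoothing half of u024 ("By (4) and (4)",
the `g`-cutoff of (4.1)–(4.3) around the window edges `P″ᵢ/(dr)`, short-interval means of `|ξ₀ⱼ(·;d,r)|` à la
Shiu) delivers an error `C𝓛⁻¹⁵·∏_{q∣dr}(1 + A/q)` with some absolute `A ≥ 0` (zl-w12-p3, STATUS 2026-08-26T23:56Z),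
which is NOT dominated by a constant multiple of `(∏_{q∣dr}(1−q⁻¹)⁻¹)²` when `A > 2`; conversely
`(∏_{q∣dr}(1−q⁻¹)⁻¹)² ≤ ∏_{q∣dr}(1 + 6/q)` (`Section8FrontEnd44ReductionRel.relFac_le_prod`). The nodes below restate
u024 and its two descendants (u026, (12.10)) with the factor `∏_{q∣dr}(1 + A/q)`, `A ≥ 0` existentially bound —
the weakest currency every producer reaches and every consumer absorbs (`Σ_{n≤x} n⁻¹∏_{q∣n}(1 + B/q) ≪_B log x`,
pattern `Section8FrontEnd44ReductionRel.weight_antidiagonal_rel_le`). Edges `U024Rel → U024RelA`,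
`DedU026readRelA`, `DedEq1210L15RelA` are PROVED in `Section12RelCompare` / `Section12RelEdgesA`. -/

section EulerMajorantCurrency

variable (c' : ℝ)

/-- **Z22:§12.u024, Euler-majorant reading** of `Sec12B.U024` (`dr ≤ P″₁/T`, `|w| = α`): both approximations
(`g`-weighted series, Perron integral on `(1)`) within `C𝓛⁻¹⁵·∏_{q∣dr}(1 + A/q)` for some absolute `C` and
`A ≥ 0`. Implied by `U024Rel` (`Section12RelCompare.u024RelA_of_u024Rel`). CLAIM.
[cite: Zhang2022LandauSiegel, §12 proof of Lemma 12.2, p.69] -/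
def U024RelA : Prop :=
  ∃ C A : ℝ, 0 ≤ A ∧ ForAllLarge fun D _ χ => AssumptionA D χ →
    ∀ j ∈ ({1, 2, 3} : Finset ℕ), ∀ d r : ℕ, 1 ≤ d → 1 ≤ r →
      ((d * r : ℕ) : ℝ) ≤ P1pp D / bigT D → ∀ w : ℂ, ‖w‖ = alpha D →
        ‖innerSum c' χ j d r w - gSeries c' χ j d r w‖ ≤
            C * (ell D ^ 15)⁻¹ * ∏ q ∈ (d * r).primeFactors, (1 + A / (q : ℝ)) ∧
        ‖innerSum c' χ j d r w - lineInt024 c' χ j d r w‖ ≤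
            C * (ell D ^ 15)⁻¹ * ∏ q ∈ (d * r).primeFactors, (1 + A / (q : ℝ))

/-- **Z22:§12.u026 (with its factor), Euler-majorant reading**: the Cauchy step with error
`C𝓛⁻⁶·∏_{q∣dr}(1 + A/q)` (⇐ `U024RelA ∧ U025Rel`, edge `DedU026readRelA`, proved in `Section12RelEdgesA`). CLAIM.
[cite: Zhang2022LandauSiegel, §12 proof of Lemma 12.2, pp.69–70] -/
def U026readRelA : Prop :=
  ∃ C A : ℝ, 0 ≤ A ∧ ForAllLarge fun D _ χ => AssumptionA D χ →
    ∀ j ∈ ({1, 2, 3} : Finset ℕ), ∀ d r : ℕ, 1 ≤ d → 1 ≤ r →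
      ((d * r : ℕ) : ℝ) ≤ P1pp D / bigT D →
        ‖deriv (bracket122 c' χ j d r) 0 -
            deriv χ.LFunction 1 * PiW χ d r * betaJ c' D (j + 1) * betaJ c' D (j + 2) *
              deriv (modelInt026 D) 0‖ ≤
          C * (ell D ^ 6)⁻¹ * ∏ q ∈ (d * r).primeFactors, (1 + A / (q : ℝ))

/-- **Z22:(12.10), Euler-majorant reading** on `dr ≤ P″₁/T`: `‖Σ − b*L′(1,χ)Π(d,r)(log P)β_{j+1}β_{j+2}‖ ≤
C·E(D)·∏_{q∣dr}(1 + A/q)` — the currency in which (12.12) (`Sec12C.Eq1212`) consumes (12.10). CLAIM.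
[cite: Zhang2022LandauSiegel, §12 (12.10) p.69] -/
def Eq1210LeRelA (E : ℕ → ℝ) : Prop :=
  ∃ C A : ℝ, 0 ≤ A ∧ ForAllLarge fun D _ χ => AssumptionA D χ →
    ∀ j ∈ ({1, 2, 3} : Finset ℕ), ∀ d r : ℕ, 1 ≤ d → 1 ≤ r →
      ((d * r : ℕ) : ℝ) ≤ P1pp D / bigT D →
        ‖sum122 c' χ j d r - main1210 c' χ j d r‖ ≤ C * E D * ∏ q ∈ (d * r).primeFactors, (1 + A / (q : ℝ))

/-- **Z22:(12.10), Euler-majorant reading at the rate `O(𝓛⁻¹⁵)`** (edge `DedEq1210L15RelA` from `U026readRelA`,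
proved in `Section12RelEdgesA`). CLAIM. [cite: Zhang2022LandauSiegel, §12 (12.10) pp.69–70] -/
def Eq1210L15RelA : Prop := Eq1210LeRelA c' fun D => (ell D ^ 15)⁻¹

/-- `Z22:§12.u026` deduction, Euler-majorant currency: `U024RelA → U025Rel → U026readRelA`
(`(∏(1−q⁻¹)⁻¹)² ≤ ∏(1+6/q)`; PROVED in `Section12RelEdgesA`). [cite: Zhang2022LandauSiegel, §12 proof of Lemma 12.2, pp.69–70] -/
def DedU026readRelA : Prop := U024RelA c' → U025Rel c' → U026readRelA c'

/-- `Z22:(12.10)` deduction, Euler-majorant currency: `U026readRelA → Eq1210L15RelA` (PROVED in `Section12RelEdgesA`).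
[cite: Zhang2022LandauSiegel, §12 (12.10) p.70] -/
def DedEq1210L15RelA : Prop := U026readRelA c' → Eq1210L15RelA c'

end EulerMajorantCurrency

end Literature.NumberTheory.LFunctions.Zhang2022.Typed.Sec12B
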